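import Summits.NavierStokesRegularity.OSWSelfSimilar.SheetRLinearisedStabilityRecord
import Summits.NavierStokesRegularity.OSWSelfSimilar.SheetRSpectrumEndToEnd
import HarnessLib

/-!
# SHEET-ℝ, Z3-SR-SPEC: «LINEARLY STABLE MODULO GAUGE» AT THE CERTIFIED ZERO `Ω*` — composed down to the hypotheses of the spectral word of record

HONEST FRAMING (cell ns-blowup GROUP B / zone Z3, case Z3-SR-SPEC; renewal route (R-a)–(R-e) of memo `HOME/profile/cert/cert5/P9-P10-RENEWAL-DESIGN.md` v2;
0 kit; 1-D MODEL certificate frame (viscous gCLM/OSW sheet on the line); computer-assisted inputs are HYPOTHESES; not Euler/NS; «violates: none — MODEL»).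
This file is COMPOSITION ONLY, the dynamical twin of `SheetRSpectrumEndToEnd`: it feeds `SheetRLinearisedStabilityRecord.exists_flow_sub_gaugeMode_le_of_certificate`
with EXACTLY the inputs of `SheetRSpectrumEndToEnd.weakEigen_set_eq_singleton_of_weakZero / _of_centre / _of_record` — the weak eigenvector at `σ = 1` is
cert-5's time-shift mode (`exists_real_gaugeMode` → `weakEigen_one_real`), the far field is the chain + ONE inequality (`farField_real`), and `f ∈ D(T)` is read
off the same chain. RESULT (`flow_stable_of_record`, literals `a = 1/5`, `λ = θ = 4`, `(c₂, c₁ + γ) = (1/5, 3/20)`, `r = rE♯₂`): modulo (i) the (S1) Gårding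
sentence at the centre `Ω̄`, (ii) `‖u‖_E ≤ rE♯₂` with `Ω* = Ω̄ + prim (der u)`, (iii) implementation 2's `RectLabelCertificate` + far-field chain + literal for the
`Ω*`-encoded Evans function, (iv) the weak zero of record with `Ω*(X₀) ≠ 0` — THE SAME LIST AS THE SPECTRAL WORD — for every `0 < β′ < 3/100`:
**the linearised flow `S_F = e^{τ(T* + 4⟪v₀+0i,·⟫(v₀+0i))}` of `−DG(Ω*)|odd` exists (C₀-semigroup, unique by its generator) and every orbit satisfies
`‖S_F(t)δ₀ − (4⟪v₀+0i, R_{K*}(1)δ₀⟫/E′(1))·e^{t}·R_{K*}(1)(v₀+0i)‖ ≤ M‖δ₀‖e^{−β′t}`** — the word «LINEARLY STABLE MODULO GAUGE (MODEL)» at the literals.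
No definition, no named fact, no number of record moves. WHAT THIS IS NOT: not NS; not a proof that any hypothesis holds; the (P10) booking is the lead's.
-/

noncomputable section

namespace Summit.NavierStokesRegularity.OSWSelfSimilar
namespace SheetRLinearisedStabilityEndToEnd

open _root_.MeasureTheory _root_.Set _root_.Filter _root_.Real Literature.Analysis.Fourier SheetRWeakProfilePV SheetRWeakToStrong
  SheetREnergyClass SheetRWeightedMeasure SheetREnergySpace SheetRLinearisedTests SheetRTestSpace SheetRLinearisedFormBounds
  SheetRSolutionOperator SheetRComplexPivot SheetRAssemblyOperators SheetRCertificateAssembly SheetRGeneratorOddWeak SheetROddClass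
  SheetRResolventOddClass SheetREvansOdd SheetRSpectrumWindingLists SheetRSpectrumOddAssembly SheetRSpectrumOddAssemblyReal SheetRWeakEigenReal
  SheetRPerturbedResolventC SheetRLinearisationPerturbation SheetRTimeShiftModeWeak SheetRTimeShiftModeWeakEigen SheetRCentreReencoding
  SheetRSpectrumEndToEnd SheetRLinearisedStability SheetRLinearisedStabilityRecord
  Literature.Analysis.OperatorTheory Literature.Analysis.UnboundedOperators Complex
open scoped Topology ENNReal InnerProductSpace ContDiff NNReal

/-! ### §1 At `Ω*`: the word from the `Ω*`-datum, the S2 certificate/chain, and the weak zero of record -/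

section AtStar

variable {L : ℝ} (hL : 0 < L) (lam a : ℝ) {Ωs Ωs₁ : ℝ → ℝ} {Hs : ℝ} (hcs : IsCentre L Ωs Ωs₁ Hs)
  (hR fR : W L) (hf : fR ∈ Wodd L) (θ : ℝ) {D₀ D₁ V₀ c m : ℝ}
  (hstar : GardingDataKC L hL (drift a Ωs) (potential L lam Ωs)
    (-PopC hL lam a hcs + (θ • ((innerSL ℝ hR).comp (ιE hL))).smulRight fR) D₀ D₁ V₀ c m)
  (hm : -m < ra)
  (hcert : RectLabelCertificate (evansOdd hL _ hstar ((innerSL ℂ (ofRealW L hR)).comp (Wcodd L).subtypeL) (realOdd fR hf) θ))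
  {z : ℂ} (hz : -m < z.re) {ac : ℕ → Wc L} (ha0 : ac 0 = ofRealW L fR)
  (hchain : ∀ j < 3, ac j = resolventKC hL _ hstar z (ac (j + 1) + z • ac j))
  (hB : ‖(θ : ℂ)‖ * (‖⟪ofRealW L hR, ac 0⟫_ℂ‖ / ((1141 : ℝ) / 100) + ‖⟪ofRealW L hR, ac 1⟫_ℂ‖ / ((1141 : ℝ) / 100) ^ 2
    + (‖⟪ofRealW L hR, ac 2⟫_ℂ‖ + ‖ofRealW L hR‖ * ‖ac 3‖ / (m + ra)) / ((1141 : ℝ) / 100) ^ 3) < 1)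
  (hweak : ∀ ψ : ℝ → ℝ, ContDiff ℝ ∞ ψ → HasCompactSupport ψ →
    (∫ x, (Ωs x + 1 / 2 * x * Ωs₁ x + a * (∫ s in (0 : ℝ)..x, hilbertTransform Ωs s) * Ωs₁ x
      - hilbertTransform Ωs x * Ωs x) * ψ x) + ∫ x, Ωs₁ x * deriv ψ x = 0)
  {X₀ : ℝ} (hX₀ : Ωs X₀ ≠ 0)

include hm hcert hz ha0 hchain hB hweak hX₀ in
/-- **«LINEARLY STABLE MODULO GAUGE» AT `Ω*`.**  Modulo the `Ω*`-encoded datum `hstar` (`−m < −3/100`), implementation 2's certificate, the far-field chain +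
literal, and the weak zero of record with `Ω*(X₀) ≠ 0`: for every `0 < β′ < 3/100` the linearised flow `S_F` of `T* + θ⟪h_R+0i,·⟫(f_R+0i)` EXISTS with the
coercive semigroup `S` of `T*` (‖S(τ)‖ ≤ e^{−mτ}, Laplace = `resolventOdd`), and every orbit is the gauge mode plus `O(‖δ₀‖e^{−β′t})`. MODEL; not NS. [folklore] -/
theorem flow_stable_of_weakZero {β' : ℝ} (hβ' : 0 < β') (hβ'3 : β' < (3 : ℝ) / 100) :
    ∃ (S SF : C0Semigroup ℂ (Wcodd L))
      (hσ₀ : -m < (((‖(((θ : ℂ)) • ((innerSL ℂ (ofRealW L hR)).comp (Wcodd L).subtypeL)).smulRight (realOdd fR hf)‖ : ℝ) : ℂ)).re),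
      S.generator = generatorOdd hL _ hstar _ hσ₀ ∧ (∀ τ : ℝ≥0, ‖S.app τ‖ ≤ Real.exp (-m * τ)) ∧
      (∀ σ : ℂ, -m < σ.re → ∀ G : Wcodd L, S.laplaceResolventFun σ G = resolventOdd hL _ hstar σ G) ∧
      ((SF.generator.domain : Set (Wcodd L)) = (generatorOdd hL _ hstar _ hσ₀).domain) ∧
      (∀ (w : Wcodd L) (hw : w ∈ (generatorOdd hL _ hstar _ hσ₀).domain), ∃ hw' : w ∈ SF.generator.domain,
        SF.generator ⟨w, hw'⟩ = generatorOdd hL _ hstar _ hσ₀ ⟨w, hw⟩ +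
          ((θ : ℂ) * ((innerSL ℂ (ofRealW L hR)).comp (Wcodd L).subtypeL) w) • realOdd fR hf) ∧
      ∃ M : ℝ, ∀ (δ₀ : Wcodd L) (t : ℝ), 0 ≤ t →
        ‖SF.app t.toNNReal δ₀ -
          ((deriv (evansOdd hL _ hstar ((innerSL ℂ (ofRealW L hR)).comp (Wcodd L).subtypeL) (realOdd fR hf) θ) 1)⁻¹ *
              ((θ : ℂ) * ((innerSL ℂ (ofRealW L hR)).comp (Wcodd L).subtypeL) (resolventOdd hL _ hstar 1 δ₀)) * cexp t) •
            resolventOdd hL _ hstar 1 (realOdd fR hf)‖ ≤ M * ‖δ₀‖ * Real.exp (-β' * t) := by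
  obtain ⟨p, hp, -, hwp⟩ := exists_real_gaugeMode hL lam a hcs hR fR θ hweak hX₀
  have hfar := farField_real hL _ hstar hm hR fR hf θ hz ha0 hchain hB
  have hv := weakEigen_one_real hL _ hstar hR fR hf θ hwp
  have ha0' : ac 0 = ((realOdd fR hf : Wcodd L) : Wc L) := by rw [coe_realOdd]; exact ha0
  exact exists_flow_sub_gaugeMode_le_of_certificate hL _ hstar hm _ _ _ hz ha0' hchain hcert hfar (cplx_ne_zero hL hp) hv hβ' hβ'3

end AtStar

/-! ### §2 Composed with the (S1) datum at the centre, frame `(8, 1/5)` -/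

section Composed

variable {h8 : (0 : ℝ) < 8} (lam : ℝ) {Ω Ω₁ Ωs Ωs₁ : ℝ → ℝ} {H₀ Hs : ℝ} (hc : IsCentre 8 Ω Ω₁ H₀) (hcs : IsCentre 8 Ωs Ωs₁ Hs)
  (u : Esp 8 h8) (hsum : ∀ y, Ωs y = Ω y + prim (der u) y)
  (hR fR : W 8) (hf : fR ∈ Wodd 8) (θ : ℝ) {D₀ D₁ V₀ c m r : ℝ}
  (hbar : GardingDataKC 8 h8 (drift (1 / 5) Ω) (potential 8 lam Ω)
    (-PopC h8 lam (1 / 5) hc + (θ • ((innerSL ℝ hR).comp (ιE h8))).smulRight fR) D₀ D₁ V₀ c m)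
  (hu : ‖u‖ ≤ r) (hcr : (CertificateViscousSheetR.Llip : ℝ) * r < c)
  (hm : -(m - CertificateViscousSheetR.Llip * r / 4) < ra)
  (hcert : RectLabelCertificate (evansOdd h8 _ (gardingDataKC_star_of_centre lam hc hcs u hsum hR fR θ hbar hu hcr)
    ((innerSL ℂ (ofRealW 8 hR)).comp (Wcodd 8).subtypeL) (realOdd fR hf) θ))
  {z : ℂ} (hz : -(m - CertificateViscousSheetR.Llip * r / 4) < z.re) {ac : ℕ → Wc 8} (ha0 : ac 0 = ofRealW 8 fR)
  (hchain : ∀ j < 3, ac j = resolventKC h8 _ (gardingDataKC_star_of_centre lam hc hcs u hsum hR fR θ hbar hu hcr) z (ac (j + 1) + z • ac j))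
  (hB : ‖(θ : ℂ)‖ * (‖⟪ofRealW 8 hR, ac 0⟫_ℂ‖ / ((1141 : ℝ) / 100) + ‖⟪ofRealW 8 hR, ac 1⟫_ℂ‖ / ((1141 : ℝ) / 100) ^ 2
    + (‖⟪ofRealW 8 hR, ac 2⟫_ℂ‖ + ‖ofRealW 8 hR‖ * ‖ac 3‖ / ((m - CertificateViscousSheetR.Llip * r / 4) + ra)) / ((1141 : ℝ) / 100) ^ 3) < 1)
  (hweak : ∀ ψ : ℝ → ℝ, ContDiff ℝ ∞ ψ → HasCompactSupport ψ →
    (∫ x, (Ωs x + 1 / 2 * x * Ωs₁ x + 1 / 5 * (∫ s in (0 : ℝ)..x, hilbertTransform Ωs s) * Ωs₁ x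
      - hilbertTransform Ωs x * Ωs x) * ψ x) + ∫ x, Ωs₁ x * deriv ψ x = 0)
  {X₀ : ℝ} (hX₀ : Ωs X₀ ≠ 0)

include hm hcert hz ha0 hchain hB hweak hX₀ in
/-- **«LINEARLY STABLE MODULO GAUGE» AT `Ω*`, composed from the centre datum** (frame `L = 8`, `a = 1/5`, any `λ`, real `θ`). MODEL; not NS. [folklore] -/
theorem flow_stable_of_centre {β' : ℝ} (hβ' : 0 < β') (hβ'3 : β' < (3 : ℝ) / 100) :
    ∃ (S SF : C0Semigroup ℂ (Wcodd 8))
      (hσ₀ : -(m - CertificateViscousSheetR.Llip * r / 4) <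
        (((‖(((θ : ℂ)) • ((innerSL ℂ (ofRealW 8 hR)).comp (Wcodd 8).subtypeL)).smulRight (realOdd fR hf)‖ : ℝ) : ℂ)).re),
      S.generator = generatorOdd h8 _ (gardingDataKC_star_of_centre lam hc hcs u hsum hR fR θ hbar hu hcr) _ hσ₀ ∧
      (∀ τ : ℝ≥0, ‖S.app τ‖ ≤ Real.exp (-(m - CertificateViscousSheetR.Llip * r / 4) * τ)) ∧
      (∀ σ : ℂ, -(m - CertificateViscousSheetR.Llip * r / 4) < σ.re → ∀ G : Wcodd 8,
        S.laplaceResolventFun σ G = resolventOdd h8 _ (gardingDataKC_star_of_centre lam hc hcs u hsum hR fR θ hbar hu hcr) σ G) ∧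
      ((SF.generator.domain : Set (Wcodd 8)) =
        (generatorOdd h8 _ (gardingDataKC_star_of_centre lam hc hcs u hsum hR fR θ hbar hu hcr) _ hσ₀).domain) ∧
      (∀ (w : Wcodd 8) (hw : w ∈ (generatorOdd h8 _ (gardingDataKC_star_of_centre lam hc hcs u hsum hR fR θ hbar hu hcr) _ hσ₀).domain),
        ∃ hw' : w ∈ SF.generator.domain,
          SF.generator ⟨w, hw'⟩ = generatorOdd h8 _ (gardingDataKC_star_of_centre lam hc hcs u hsum hR fR θ hbar hu hcr) _ hσ₀ ⟨w, hw⟩ +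
            ((θ : ℂ) * ((innerSL ℂ (ofRealW 8 hR)).comp (Wcodd 8).subtypeL) w) • realOdd fR hf) ∧
      ∃ M : ℝ, ∀ (δ₀ : Wcodd 8) (t : ℝ), 0 ≤ t →
        ‖SF.app t.toNNReal δ₀ -
          ((deriv (evansOdd h8 _ (gardingDataKC_star_of_centre lam hc hcs u hsum hR fR θ hbar hu hcr)
              ((innerSL ℂ (ofRealW 8 hR)).comp (Wcodd 8).subtypeL) (realOdd fR hf) θ) 1)⁻¹ *
              ((θ : ℂ) * ((innerSL ℂ (ofRealW 8 hR)).comp (Wcodd 8).subtypeL)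
                (resolventOdd h8 _ (gardingDataKC_star_of_centre lam hc hcs u hsum hR fR θ hbar hu hcr) 1 δ₀)) * cexp t) •
            resolventOdd h8 _ (gardingDataKC_star_of_centre lam hc hcs u hsum hR fR θ hbar hu hcr) 1 (realOdd fR hf)‖ ≤
          M * ‖δ₀‖ * Real.exp (-β' * t) :=
  flow_stable_of_weakZero h8 lam (1 / 5) hcs hR fR hf θ (gardingDataKC_star_of_centre lam hc hcs u hsum hR fR θ hbar hu hcr)
    hm hcert hz ha0 hchain hB hweak hX₀ hβ' hβ'3

end Composed

/-! ### §3 The literals of record -/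

section Record

variable {h8 : (0 : ℝ) < 8} {Ω Ω₁ Ωs Ωs₁ : ℝ → ℝ} {H₀ Hs : ℝ} (hc : IsCentre 8 Ω Ω₁ H₀) (hcs : IsCentre 8 Ωs Ωs₁ Hs)
  (u : Esp 8 h8) (hsum : ∀ y, Ωs y = Ω y + prim (der u) y)
  (hR : W 8) (hh : hR ∈ Wodd 8) {D₀ D₁ V₀ : ℝ}
  (hS1 : GardingDataKC 8 h8 (drift (1 / 5) Ω) (potential 8 4 Ω)
    (-PopC h8 4 (1 / 5) hc + ((4 : ℝ) • ((innerSL ℝ hR).comp (ιE h8))).smulRight hR) D₀ D₁ V₀ (1 / 5) (3 / 20))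
  (hu : ‖u‖ ≤ (CertificateViscousSheetR.rEsharp2 : ℝ))
  (hcert : RectLabelCertificate (evansOdd h8 _
    (gardingDataKC_star_of_centre 4 hc hcs u hsum hR hR 4 hS1 hu Llip_mul_rEsharp2_lt)
    ((innerSL ℂ (ofRealW 8 hR)).comp (Wcodd 8).subtypeL) (realOdd hR hh) 4))
  {z : ℂ} (hz : -((3 : ℝ) / 20 - CertificateViscousSheetR.Llip * CertificateViscousSheetR.rEsharp2 / 4) < z.re) {ac : ℕ → Wc 8}
  (ha0 : ac 0 = ofRealW 8 hR)
  (hchain : ∀ j < 3, ac j = resolventKC h8 _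
    (gardingDataKC_star_of_centre 4 hc hcs u hsum hR hR 4 hS1 hu Llip_mul_rEsharp2_lt) z (ac (j + 1) + z • ac j))
  (hB : ‖((4 : ℝ) : ℂ)‖ * (‖⟪ofRealW 8 hR, ac 0⟫_ℂ‖ / ((1141 : ℝ) / 100) + ‖⟪ofRealW 8 hR, ac 1⟫_ℂ‖ / ((1141 : ℝ) / 100) ^ 2
    + (‖⟪ofRealW 8 hR, ac 2⟫_ℂ‖ + ‖ofRealW 8 hR‖ * ‖ac 3‖
        / (((3 : ℝ) / 20 - CertificateViscousSheetR.Llip * CertificateViscousSheetR.rEsharp2 / 4) + ra)) / ((1141 : ℝ) / 100) ^ 3) < 1)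
  (hweak : ∀ ψ : ℝ → ℝ, ContDiff ℝ ∞ ψ → HasCompactSupport ψ →
    (∫ x, (Ωs x + 1 / 2 * x * Ωs₁ x + 1 / 5 * (∫ s in (0 : ℝ)..x, hilbertTransform Ωs s) * Ωs₁ x
      - hilbertTransform Ωs x * Ωs x) * ψ x) + ∫ x, Ωs₁ x * deriv ψ x = 0)
  {X₀ : ℝ} (hX₀ : Ωs X₀ ≠ 0)

include hcert hz ha0 hchain hB hweak hX₀ in
/-- **THE WORD «LINEARLY STABLE MODULO GAUGE (MODEL)» AT THE LITERALS OF RECORD** (`a = 1/5`, `λ = θ = 4`, `h_R = f_R = v₀` an odd real `L²_w` class,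
`(c₂, c₁ + γ) = (1/5, 3/20)`, `r = rE♯₂`; `m* = 3/20 − L_lip·rE♯₂/4`): modulo the SAME sentences as `SheetRSpectrumEndToEnd.weakEigen_set_eq_singleton_of_record`
— for every `0 < β′ < 3/100` the linearised flow of `−DG(Ω*)|odd` exists and every orbit is `(4⟪v₀+0i, R_{K*}(1)δ₀⟫/E′(1))·e^{t}·R_{K*}(1)(v₀+0i) + O(‖δ₀‖e^{−β′t})`.
MODEL statement; not NS. [folklore] -/
theorem flow_stable_of_record {β' : ℝ} (hβ' : 0 < β') (hβ'3 : β' < (3 : ℝ) / 100) :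
    ∃ (S SF : C0Semigroup ℂ (Wcodd 8))
      (hσ₀ : -((3 : ℝ) / 20 - CertificateViscousSheetR.Llip * CertificateViscousSheetR.rEsharp2 / 4) <
        (((‖((((4 : ℝ) : ℂ)) • ((innerSL ℂ (ofRealW 8 hR)).comp (Wcodd 8).subtypeL)).smulRight (realOdd hR hh)‖ : ℝ) : ℂ)).re),
      S.generator = generatorOdd h8 _ (gardingDataKC_star_of_centre 4 hc hcs u hsum hR hR 4 hS1 hu Llip_mul_rEsharp2_lt) _ hσ₀ ∧
      (∀ τ : ℝ≥0, ‖S.app τ‖ ≤ Real.exp (-((3 : ℝ) / 20 - CertificateViscousSheetR.Llip * CertificateViscousSheetR.rEsharp2 / 4) * τ)) ∧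
      (∀ σ : ℂ, -((3 : ℝ) / 20 - CertificateViscousSheetR.Llip * CertificateViscousSheetR.rEsharp2 / 4) < σ.re → ∀ G : Wcodd 8,
        S.laplaceResolventFun σ G =
          resolventOdd h8 _ (gardingDataKC_star_of_centre 4 hc hcs u hsum hR hR 4 hS1 hu Llip_mul_rEsharp2_lt) σ G) ∧
      ((SF.generator.domain : Set (Wcodd 8)) =
        (generatorOdd h8 _ (gardingDataKC_star_of_centre 4 hc hcs u hsum hR hR 4 hS1 hu Llip_mul_rEsharp2_lt) _ hσ₀).domain) ∧
      (∀ (w : Wcodd 8) (hw : w ∈ (generatorOdd h8 _ (gardingDataKC_star_of_centre 4 hc hcs u hsum hR hR 4 hS1 hu Llip_mul_rEsharp2_lt) _ hσ₀).domain),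
        ∃ hw' : w ∈ SF.generator.domain,
          SF.generator ⟨w, hw'⟩ =
            generatorOdd h8 _ (gardingDataKC_star_of_centre 4 hc hcs u hsum hR hR 4 hS1 hu Llip_mul_rEsharp2_lt) _ hσ₀ ⟨w, hw⟩ +
              (((4 : ℝ) : ℂ) * ((innerSL ℂ (ofRealW 8 hR)).comp (Wcodd 8).subtypeL) w) • realOdd hR hh) ∧
      ∃ M : ℝ, ∀ (δ₀ : Wcodd 8) (t : ℝ), 0 ≤ t →
        ‖SF.app t.toNNReal δ₀ -
          ((deriv (evansOdd h8 _ (gardingDataKC_star_of_centre 4 hc hcs u hsum hR hR 4 hS1 hu Llip_mul_rEsharp2_lt)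
              ((innerSL ℂ (ofRealW 8 hR)).comp (Wcodd 8).subtypeL) (realOdd hR hh) 4) 1)⁻¹ *
              (((4 : ℝ) : ℂ) * ((innerSL ℂ (ofRealW 8 hR)).comp (Wcodd 8).subtypeL)
                (resolventOdd h8 _ (gardingDataKC_star_of_centre 4 hc hcs u hsum hR hR 4 hS1 hu Llip_mul_rEsharp2_lt) 1 δ₀)) * cexp t) •
            resolventOdd h8 _ (gardingDataKC_star_of_centre 4 hc hcs u hsum hR hR 4 hS1 hu Llip_mul_rEsharp2_lt) 1 (realOdd hR hh)‖ ≤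
          M * ‖δ₀‖ * Real.exp (-β' * t) :=
  flow_stable_of_centre 4 hc hcs u hsum hR hR hh 4 hS1 hu Llip_mul_rEsharp2_lt neg_mstar_lt_ra hcert hz ha0 hchain hB hweak hX₀ hβ' hβ'3

end Record

end SheetRLinearisedStabilityEndToEnd
end Summit.NavierStokesRegularity.OSWSelfSimilar
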